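import Summits.Ventures.AbcSig.Rows.StatementsC1b
import Summits.Ventures.AbcSig.Rows.Xn64Yn21Z2Q

/-!
# Venture AbcSig — CELL bridge for `xⁿ + 2^α yⁿ = 21 z²` (FAMILY C1b, `α = 6`): p1's census predicate `Rows.C1bCell 21 (fun _ α => α = 6) 11 ∅`

Q-VARIANT (p-lean g6 `gen6/spatch2.py`) of `C1bCell_21_a6_of`: kernel sieve discharges (q = 2 rule, one extra named hypothesis hQ : M.Q2Package) replace the cited pair(s) 441.2 @ 11, 441.2 @ 13, 441.3 @ 11, 441.3 @ 13 (see the row file(s) `Rows/Xn64Yn21Z2Q.lean`).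
HONEST FRAMING. COMPUTATION cell `pub-abcsig`; CONDITIONAL theorem; no claim on ABC or any summit. Hypotheses exactly
those of `Rows/Xn64Yn21Z2X.lean` (`xrow_Xn64Yn21Z2`): `BS04Package` (CITED), `DataComplete` at the two levels (COMPUTED, certified level
files) and the row's per-orbit CITED exclusions `hX_…`, universally quantified in the exponent. Conclusion = the conjunct
`Rows.C1bCell 21 (fun _ α => α = 6) 11 ∅` of p1's `Rows.C1bSmallAlphaSigned` / `Rows.C1bExtSigned`
(`Rows/StatementsC1b.lean`; row of record `census/rows/C1b/C1b-C21-a6.md`, R8-signed): every prime `n ≥ 11`, `n ∤ 21`,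
`α = 6`, no primitive solution with `|xy| > 1`. GENERATED by p-lean gen3/make_c1bcell.py (pattern of `Rows/Xn8Yn11Z2Cell.lean`).
-/

namespace Summit.Ventures.AbcSig

/-- `xⁿ + 2^α yⁿ = 21z²` (`α = 6`), every prime `n ≥ 11` with `n ∤ 21`, `|xy| > 1`: p1's conjunct
`Rows.C1bCell 21 (fun _ α => α = 6) 11 ∅` from `xrow_Xn64Yn21Z2`. -/
theorem C1bCell_21_a6Q_of (M : NewformModel) (hP : M.BS04Package) (hQ : M.Q2Package)
    (hD441 : M.DataComplete 441 level441Orbits)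
    (hD882 : M.DataComplete 882 level882Orbits)
    (hX_orbit_441_1 : ∀ n : ℕ, M.Excludes 441 orbit_441_1 (famBC 6 21 n (fun _ b => ¬ 2 ∣ b)))
    (hQ2_orbit_441_2 : ∀ f : M.Form 441, M.Matches f orbit_441_2 → M.Matches f q2_441_2)
    (hQ2_orbit_441_3 : ∀ f : M.Form 441, M.Matches f orbit_441_3 → M.Matches f q2_441_3)
    (hX_orbit_441_4 : ∀ n : ℕ, M.Excludes 441 orbit_441_4 (famBC 6 21 n (fun _ b => ¬ 2 ∣ b)))
    (hX_orbit_882_1 : ∀ n : ℕ, M.Excludes 882 orbit_882_1 (famBC 6 21 n (fun _ b => 2 ∣ b)))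
    (hX_orbit_882_6 : ∀ n : ℕ, M.Excludes 882 orbit_882_6 (famBC 6 21 n (fun _ b => 2 ∣ b)))
    (hX_orbit_882_8 : ∀ n : ℕ, M.Excludes 882 orbit_882_8 (famBC 6 21 n (fun _ b => 2 ∣ b)))
    (hX_orbit_882_12 : ∀ n : ℕ, M.Excludes 882 orbit_882_12 (famBC 6 21 n (fun _ b => 2 ∣ b))) :
    Rows.C1bCell 21 (fun _ α => α = 6) 11 ∅ := by
  intro n hn h0 _ _ α hα x y z h1 h2
  subst hα
  exact xrow_Xn64Yn21Z2Q M hP hQ hD441 hD882 n hn h0 (hX_orbit_441_1 n) hQ2_orbit_441_2 hQ2_orbit_441_3 (hX_orbit_441_4 n) (hX_orbit_882_1 n) (hX_orbit_882_6 n) (hX_orbit_882_8 n) (hX_orbit_882_12 n) x y z h1 h2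

end Summit.Ventures.AbcSig
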